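import Summits.Ventures.CertifiedManyBodySolver.Rows.RectMarginalNodes
import HarnessLib

/-!
# Square-lattice window-marginal nodes — part 2/4: §3  The PROVED edge: an Anderson cluster floor is a `TIStateNode` (all densities, no positivity of `U` needed)

HONEST FRAMING: first certified bounds; not a superconductivity verdict; every number certified or labelled float.
This module proves SOUNDNESS / DOMINANCE statements (inequalities between relaxations); it certifies no new number.

Continuation of `Rows/RectMarginalNodes.lean` (full module docstring, conventions, named gaps G-SYM-2D / G-ISO there). THIS module: §3 the PROVED edge Anderson cluster floor ⇒ `TIStateNode` (`tiStateNode_of_andersonCluster_transposePair`, `tiStateNode_of_andersonRect`, instance `tiStateNode_of_rect2x4rot_opt_U8`) and §4 the matrix-level node `LTIRectNode` (`WindowLTI`, `hAvg`) with its PROVED soundness `LTIRectNode.tiStateNode` / `.m3EnergyLowerRow` / `.m2EnergyLowerRow`.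

FILING NOTE (sr-mbsolver-lit-4 g9, 2026-08-22): the four modules `Rows/RectMarginalNodes.lean` → `…Anderson.lean` → `…Dominance.lean` → `…GS.lean`
are sr-mbsolver-op-07 gen-11's PROVED HOME file `HOME/sr-mbsolver-op-07/lean/RectMarginalNodes.lean` (sha256 b7b18754ae1e5299…, 1 018 lines, 71 theorems +
15 defs, sorry-free; FILE REQUEST HOME INBOX l.4956, one-writer rule) split at its §3 / §5 / §6 headings to respect the gate's 400-line module
limit, with the working namespace `…CertifiedManyBodySolver.Sketch2D` renamed `Summit.Ventures.CertifiedManyBodySolver.Rows.RectMarginalNodes`; declarations,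
statements and proofs are otherwise VERBATIM except two gate-driven edits: op-07's `sum_polySite_eq` is replaced by the landed
`Rows.AndersonDominatedByLTI.sum_ofLex_eq'` (dedup) and 22 one-line docstrings were added (lint.docstring). Contents by module: (1) §0 bookkeeping, §1 the TI dictionary (`bondEnergy` / `siteEnergy` / `densityC`, `expect_clusterHamiltonian`, `hubbardEnergyDensity_eq_re`), §2 `TIStateNode` + transport `TIStateNode.le_energyDensity2D`, tightness, cells `.m2EnergyLowerRow` / `.m3EnergyLowerRow`; (2) §3 the PROVED edge Anderson cluster floor ⇒ `TIStateNode` (`tiStateNode_of_andersonCluster_transposePair`, `tiStateNode_of_andersonRect`, instance `tiStateNode_of_rect2x4rot_opt_U8`) and §4 the matrix-level node `LTIRectNode` (`WindowLTI`, `hAvg`) with its PROVED soundness `LTIRectNode.tiStateNode` / `.m3EnergyLowerRow` / `.m2EnergyLowerRow`;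
(3) §5 the window-LTI matrix dictionary (`wfun`, `WindowLTI.wfun_*`, `wBond` / `wSite` / `wDens`) and the DOMINANCE edge `ltiRectNode_of_andersonCluster_subset` (+ `_andersonRect_subset`, `_andersonCluster_transposePair_subset`, instance `ltiRectNode_of_rect2x4rot_opt_U8`); (4) §6 the ground-state-class node `LTIRectGSNode` (LTI + `S^z` + local-stability rows, `stabilityObs`) with its PROVED soundness `LTIRectGSNode.le_energyDensity2D` / cells and `LTIRectNode.gsNode`.
-/

noncomputable section

open Matrix Complex Finset
open scoped ComplexOrder MatrixOrder BigOperators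
open Literature.Probability.LatticeModels
open Literature.MathematicalPhysics.QuantumLattice
open Literature.MathematicalPhysics.QuantumLattice.AndersonCluster
open Literature.MathematicalPhysics.QuantumLattice.HubbardWave0
open Literature.MathematicalPhysics.QuantumLattice.ThermodynamicLimit

namespace Summit.Ventures.CertifiedManyBodySolver.Rows.RectMarginalNodes

/-! ## §3  The PROVED edge: an Anderson cluster floor is a `TIStateNode` (all densities, no positivity of `U` needed) -/

section AndersonEdge

/-- Positivity read as a bound: `A - q·1 ⪰ 0 ⇒ q ≤ Re ω(A)`. -/
theorem le_re_expect_of_posSemidef_sub (ω : InfVolFermionState 2) {Λ : Finset (Site 2)} {A : FermionOp Λ}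
    {q : ℝ} (hq : (A - (q : ℂ) • (1 : FermionOp Λ)).PosSemidef) : q ≤ (ω.expect Λ A).re := by
  have h := ω.expect_re_nonneg_of_posSemidef Λ hq
  rw [map_sub, map_smul, ω.expect_one, Complex.sub_re, smul_eq_mul, mul_one, Complex.ofReal_re] at h
  linarith

/-- `Σ_x (c · V x) = c · Σ_x V x` for site weights. -/
theorem siteWeightSum_const_mul (R : Finset (Site 2)) (c : ℝ) (V : Site 2 → ℝ) :
    siteWeightSum R (fun x => c * V x) = c * siteWeightSum R V := by
  rw [AndersonCluster.siteWeightSum, AndersonCluster.siteWeightSum, Finset.mul_sum]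

/-- **Expectation of a weighted Anderson cluster in a translation-invariant state**:
`ω(h(R; w, v)) = Σ_i W_i h_i + (Σv) u - (U/2)(Σv) ω(n_0) + (U/2)(Σv)`. -/
theorem expect_andersonCluster {t U : ℝ} {ω : InfVolFermionState 2} (hω : ω.IsTranslationInvariant)
    (R : Finset (Site 2)) (w : Site 2 → Fin 2 → ℝ) (v : Site 2 → ℝ) :
    ω.expect R (andersonCluster R t U w v) =
      ∑ i : Fin 2, ((bondWeightSum R w i : ℝ) : ℂ) * bondEnergy t U ω i +
        ((siteWeightSum R v : ℝ) : ℂ) * siteEnergy t U ω +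
        ((-(U / 2) * siteWeightSum R v : ℝ) : ℂ) * densityC ω + ((U / 2 * siteWeightSum R v : ℝ) : ℂ) := by
  rw [andersonCluster_eq, map_add, map_smul, ω.expect_one, expect_clusterHamiltonian hω R, smul_eq_mul, mul_one,
    siteWeightSum_const_mul]

/-! ### §3.1 Transposition bookkeeping (the tree's versions are file-private; re-derived) -/

/-- `swapSite` is an involution (local copy of a file-private tree lemma; `private` here too — a near-duplicate statement exists in an unrelated Summits file). -/
private theorem swapSite_swapSite' (x : Site 2) : swapSite (swapSite x) = x := by
  funext i; simp [swapSite, Fin.rev_rev]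

/-- The coordinate swap is additive (local copy of a file-private tree lemma; `rfl`; `private` — near-duplicate statement in an unrelated Literature file). -/
private theorem swapSite_add' (x y : Site 2) : swapSite (x + y) = swapSite x + swapSite y := rfl

/-- The coordinate swap exchanges the unit vectors: `swapSite e_i = e_{1-i}` (local copy of a file-private tree lemma). -/
theorem swapSite_unitVec' (i : Fin 2) : swapSite (unitVec i) = unitVec i.rev := by
  funext j
  simp only [swapSite, unitVec, Pi.single_apply]
  by_cases h : j.rev = i
  · rw [if_pos h, if_pos (Fin.rev_eq_iff.1 h)]
  · rw [if_neg h, if_neg (fun h' => h (Fin.rev_eq_iff.2 h'))]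

/-- Membership in the transposed region: `z ∈ Rᵀ ↔ swapSite z ∈ R` (local copy of a file-private tree lemma). -/
theorem mem_transposeWindow' {R : Finset (Site 2)} {z : Site 2} : z ∈ transposeWindow R ↔ swapSite z ∈ R := by
  rw [transposeWindow, Finset.mem_map]
  constructor
  · rintro ⟨x, hx, rfl⟩
    change swapSite (swapSite x) ∈ R
    rwa [swapSite_swapSite']
  · intro h
    exact ⟨swapSite z, h, swapSite_swapSite' z⟩

/-- Bond weights of direction `i` of the transpose are those of direction `rev i`. -/
theorem bondWeightSum_transpose' (R : Finset (Site 2)) (w : Site 2 → Fin 2 → ℝ) (i : Fin 2) :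
    bondWeightSum (transposeWindow R) (fun x i => w (swapSite x) i.rev) i = bondWeightSum R w i.rev := by
  rw [AndersonCluster.bondWeightSum, AndersonCluster.bondWeightSum, transposeWindow, Finset.sum_map]
  refine Finset.sum_congr rfl fun x _ => ?_
  simp only [AndersonCluster.bondWeight, Function.Embedding.coeFn_mk, swapSite_swapSite']
  have hiff : swapSite x + unitVec i ∈ transposeWindow R ↔ x + unitVec i.rev ∈ R := by
    rw [mem_transposeWindow', swapSite_add', swapSite_swapSite', swapSite_unitVec']
  rw [transposeWindow] at hiff
  by_cases h : x + unitVec i.rev ∈ R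
  · rw [if_pos (hiff.2 h), if_pos h]
  · rw [if_neg (fun h' => h (hiff.1 h')), if_neg h]

/-- Site weights are unchanged by transposition. -/
theorem siteWeightSum_transpose' (R : Finset (Site 2)) (v : Site 2 → ℝ) :
    siteWeightSum (transposeWindow R) (fun x => v (swapSite x)) = siteWeightSum R v := by
  rw [AndersonCluster.siteWeightSum, AndersonCluster.siteWeightSum, transposeWindow, Finset.sum_map]
  refine Finset.sum_congr rfl fun x _ => ?_
  show v (swapSite (swapSite x)) = v x
  rw [swapSite_swapSite']

/-! ### §3.2 The edge -/

/-- **EDGE (Anderson ⇒ TI-state node), general weighted cluster.**  A weighted open cluster `R ⊆ ℤ²` with TOTAL bond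
weight `W_0 + W_1 = 2`, site weight `Σ v = 1` and a certified floor `h(R; w, v) ⪰ q` gives, for EVERY
translation-invariant state `ω` of density `n` (no ground-state, no torus-limit, no sign-of-`U` hypothesis):
`e(ω) ≥ q - (U/2)(1 - n)`.  Proof: `q ≤ Re ω(h(R)) = W_0 Re h_0 + W_1 Re h_1 + Re u - (U/2) n + U/2` and the same for
the transposed cluster `Rᵀ` (weights `W_1, W_0`, same floor `posSemidef_andersonCluster_transpose`); add. -/
theorem tiStateNode_of_andersonCluster_transposePair (t U n : ℝ) (R : Finset (Site 2)) (w : Site 2 → Fin 2 → ℝ)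
    (v : Site 2 → ℝ) {q : ℝ} (hw : bondWeightSum R w 0 + bondWeightSum R w 1 = 2) (hv : siteWeightSum R v = 1)
    (hq : (andersonCluster R t U w v - (q : ℂ) • (1 : FermionOp R)).PosSemidef) :
    TIStateNode t U n (q - U / 2 * (1 - n)) := by
  intro ω hti _ hd
  have h1 := le_re_expect_of_posSemidef_sub ω hq
  have h2 := le_re_expect_of_posSemidef_sub ω (posSemidef_andersonCluster_transpose hq)
  rw [expect_andersonCluster hti, hv] at h1
  rw [expect_andersonCluster hti, siteWeightSum_transpose', hv, Fin.sum_univ_two, bondWeightSum_transpose',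
    bondWeightSum_transpose'] at h2
  have e1 : (0 : Fin 2).rev = 1 := rfl
  have e2 : (1 : Fin 2).rev = 0 := rfl
  rw [e1, e2] at h2
  rw [Fin.sum_univ_two] at h1
  rw [hubbardEnergyDensity_eq_re hti, Fin.sum_univ_two]
  rw [density_eq_re_densityC] at hd
  simp only [Complex.add_re, Complex.mul_re, Complex.ofReal_re, Complex.ofReal_im, zero_mul, sub_zero, hd]
    at h1 h2 ⊢
  have hW1 : bondWeightSum R w 1 = 2 - bondWeightSum R w 0 := by linarith
  rw [hW1] at h1 h2
  linarith

/-! ### §3.3 Rectangles in coordinates (the tree's versions are file-private; re-derived) -/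

/-- `Σ_{r<b} (if r+1<b then f r else 0) = Σ_{r<b-1} f r` (local copy of a file-private tree lemma). -/
theorem sum_range_ite_succ_lt' (b : ℕ) (f : ℕ → ℝ) :
    ∑ k ∈ Finset.range b, (if k + 1 < b then f k else 0) = ∑ k ∈ Finset.range (b - 1), f k := by
  cases b with
  | zero => simp
  | succ n =>
    rw [Finset.sum_range_succ, if_neg (by omega), add_zero, Nat.add_sub_cancel]
    exact Finset.sum_congr rfl fun j hj => by rw [if_pos (by have := Finset.mem_range.1 hj; omega)]

/-- Membership in the rectangle `[0,a) × [0,b)` in coordinates (local copy of a file-private tree lemma). -/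
theorem mem_rectWindow' {a b : ℕ} {x : Site 2} :
    x ∈ rectWindow a b ↔ (0 ≤ x 0 ∧ x 0 < a) ∧ (0 ≤ x 1 ∧ x 1 < b) := by
  rw [rectWindow, Finset.mem_filter, mem_halfOpenBox, Fin.forall_fin_two]
  push_cast
  constructor
  · rintro ⟨⟨h0, h1⟩, ha, hb⟩
    exact ⟨⟨h0.1, ha⟩, ⟨h1.1, hb⟩⟩
  · rintro ⟨⟨h0, ha⟩, ⟨h1, hb⟩⟩
    exact ⟨⟨⟨h0, by omega⟩, ⟨h1, by omega⟩⟩, ha, hb⟩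

/-- First coordinate of `mkSite2 c r` (local copy of a file-private tree simp lemma). -/
@[simp] theorem mkSite2_zero' (c r : ℕ) : mkSite2 c r 0 = c := rfl
/-- Second coordinate of `mkSite2 c r` (local copy of a file-private tree simp lemma). -/
@[simp] theorem mkSite2_one' (c r : ℕ) : mkSite2 c r 1 = r := rfl

/-- A sum over the rectangle `[0,a) × [0,b)` is the double sum over column and row indices (local copy of a file-private tree lemma). -/
theorem sum_rectWindow_eq' (a b : ℕ) (f : Site 2 → ℝ) :
    ∑ x ∈ rectWindow a b, f x = ∑ c ∈ Finset.range a, ∑ r ∈ Finset.range b, f (mkSite2 c r) := by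
  rw [← Finset.sum_product']
  refine Finset.sum_nbij' (fun x => ((x 0).toNat, (x 1).toNat)) (fun p => mkSite2 p.1 p.2) ?_ ?_ ?_ ?_ ?_
  · intro x hx
    have h := mem_rectWindow'.1 (Finset.mem_coe.1 hx)
    exact Finset.mem_coe.2 (Finset.mem_product.2 ⟨Finset.mem_range.2 (by omega), Finset.mem_range.2 (by omega)⟩)
  · intro p hp
    have h := Finset.mem_product.1 (Finset.mem_coe.1 hp)
    have h1 := Finset.mem_range.1 h.1
    have h2 := Finset.mem_range.1 h.2
    exact Finset.mem_coe.2 (mem_rectWindow'.2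
      ⟨⟨by simp, by simp; exact_mod_cast h1⟩, ⟨by simp, by simp; exact_mod_cast h2⟩⟩)
  · intro x hx
    have h := mem_rectWindow'.1 (Finset.mem_coe.1 hx)
    funext i
    fin_cases i
    · show (((x 0).toNat : ℕ) : ℤ) = x 0
      exact Int.toNat_of_nonneg h.1.1
    · show (((x 1).toNat : ℕ) : ℤ) = x 1
      exact Int.toNat_of_nonneg h.2.1
  · intro p _
    simp
  · intro x hx
    have h := mem_rectWindow'.1 (Finset.mem_coe.1 hx)
    show f x = f (mkSite2 (x 0).toNat (x 1).toNat)
    congr 1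
    funext i
    fin_cases i
    · show x 0 = (((x 0).toNat : ℕ) : ℤ)
      exact (Int.toNat_of_nonneg h.1.1).symm
    · show x 1 = (((x 1).toNat : ℕ) : ℤ)
      exact (Int.toNat_of_nonneg h.2.1).symm

/-- The site-weight sum of a rectangle table is the double sum of its entries (local copy of a file-private tree lemma). -/
theorem siteWeightSum_rect' (a b : ℕ) (v : ℕ → ℕ → ℝ) :
    siteWeightSum (rectWindow a b) (rectSiteWeights v) = ∑ c ∈ Finset.range a, ∑ r ∈ Finset.range b, v c r := by
  rw [AndersonCluster.siteWeightSum, sum_rectWindow_eq']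
  refine Finset.sum_congr rfl fun c _ => Finset.sum_congr rfl fun r _ => ?_
  simp [rectSiteWeights]

/-- The horizontal (`e_0`) bond-weight sum of a rectangle table (local copy of a file-private tree lemma). -/
theorem bondWeightSum_rect_zero' (a b : ℕ) (w : ℕ → ℕ → Fin 2 → ℝ) :
    bondWeightSum (rectWindow a b) (rectBondWeights w) 0 =
      ∑ c ∈ Finset.range (a - 1), ∑ r ∈ Finset.range b, w c r 0 := by
  rw [AndersonCluster.bondWeightSum, sum_rectWindow_eq']
  have h1 : ∀ c ∈ Finset.range a, ∀ r ∈ Finset.range b,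
      bondWeight (rectWindow a b) (rectBondWeights w) (mkSite2 c r) 0 = if c + 1 < a then w c r 0 else 0 := by
    intro c hc r hr
    have hc' := Finset.mem_range.1 hc
    have hr' := Finset.mem_range.1 hr
    have hiff : mkSite2 c r + unitVec 0 ∈ rectWindow a b ↔ c + 1 < a := by
      rw [mem_rectWindow']
      simp only [Pi.add_apply, unitVec, Pi.single_eq_same, Pi.single_eq_of_ne (one_ne_zero (α := Fin 2)),
        mkSite2_zero', mkSite2_one', add_zero]
      omega
    simp only [AndersonCluster.bondWeight, rectBondWeights, mkSite2_zero', mkSite2_one', Int.toNat_natCast]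
    by_cases h : c + 1 < a
    · rw [if_pos (hiff.2 h), if_pos h]
    · rw [if_neg (fun h' => h (hiff.1 h')), if_neg h]
  rw [Finset.sum_congr rfl fun c hc => Finset.sum_congr rfl fun r hr => h1 c hc r hr]
  rw [Finset.sum_comm, ← sum_range_ite_succ_lt' a (fun c => ∑ r ∈ Finset.range b, w c r 0), Finset.sum_comm]
  refine Finset.sum_congr rfl fun c _ => ?_
  split_ifs <;> simp

/-- The vertical (`e_1`) bond-weight sum of a rectangle table (local copy of a file-private tree lemma). -/
theorem bondWeightSum_rect_one' (a b : ℕ) (w : ℕ → ℕ → Fin 2 → ℝ) :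
    bondWeightSum (rectWindow a b) (rectBondWeights w) 1 =
      ∑ c ∈ Finset.range a, ∑ r ∈ Finset.range (b - 1), w c r 1 := by
  rw [AndersonCluster.bondWeightSum, sum_rectWindow_eq']
  refine Finset.sum_congr rfl fun c hc => ?_
  have hc' := Finset.mem_range.1 hc
  rw [← sum_range_ite_succ_lt' b (fun r => w c r 1)]
  refine Finset.sum_congr rfl fun r hr => ?_
  have hr' := Finset.mem_range.1 hr
  have hiff : mkSite2 c r + unitVec 1 ∈ rectWindow a b ↔ r + 1 < b := by
    rw [mem_rectWindow']
    simp only [Pi.add_apply, unitVec, Pi.single_eq_same, Pi.single_eq_of_ne (zero_ne_one (α := Fin 2)),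
      mkSite2_zero', mkSite2_one', add_zero]
    omega
  simp only [AndersonCluster.bondWeight, rectBondWeights, mkSite2_zero', mkSite2_one', Int.toNat_natCast]
  by_cases h : r + 1 < b
  · rw [if_pos (hiff.2 h), if_pos h]
  · rw [if_neg (fun h' => h (hiff.1 h')), if_neg h]

/-- **EDGE (Anderson ⇒ TI-state node), rectangles in coordinates** — the form the tree's certificate rows
`anderson_psd_rect<b>x<a>rot_*` are stated in (`a` columns `c`, `b` rows `r`, bond table `w c r i`, site table `v c r`). -/
theorem tiStateNode_of_andersonRect (t U n : ℝ) (a b : ℕ) (w : ℕ → ℕ → Fin 2 → ℝ) (v : ℕ → ℕ → ℝ) {q : ℝ}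
    (hw : (∑ c ∈ Finset.range (a - 1), ∑ r ∈ Finset.range b, w c r 0) +
      (∑ c ∈ Finset.range a, ∑ r ∈ Finset.range (b - 1), w c r 1) = 2)
    (hv : ∑ c ∈ Finset.range a, ∑ r ∈ Finset.range b, v c r = 1)
    (hq : (andersonCluster (rectWindow a b) t U (rectBondWeights w) (rectSiteWeights v) -
      (q : ℂ) • (1 : FermionOp (rectWindow a b))).PosSemidef) :
    TIStateNode t U n (q - U / 2 * (1 - n)) :=
  tiStateNode_of_andersonCluster_transposePair t U n (rectWindow a b) (rectBondWeights w) (rectSiteWeights v)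
    (by rw [bondWeightSum_rect_zero', bondWeightSum_rect_one']; exact hw) (by rw [siteWeightSum_rect']; exact hv) hq

open Summit.HubbardSuperconductivity.ManyBodyBootstrap.Bounds in
/-- **Instance: the programme's best 2-D cluster row at `U = 8`** (`anderson_psd_rect2x4rot_opt_U8`, a `4 × 2`
rectangle, optimised weights, floor `q = -214327093049334212810432623 / 281474976710656000000000000 ≈ -0.76144`):
for EVERY density `n`, `TIStateNode 1 8 n (q - 4 (1 - n))`; at the target of record `n = 7/8` this is
`q - 1/2 ≈ -1.2614` (the tree's certified `-0.8931` at `n = 7/8` comes from a DIFFERENT, density-specific mechanism —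
this instance only shows the edge is live on a real row). -/
theorem tiStateNode_of_rect2x4rot_opt_U8 (n : ℝ) (h : anderson_psd_rect2x4rot_opt_U8) :
    TIStateNode 1 8 n
      ((((-214327093049334212810432623 / 281474976710656000000000000 : ℚ) : ℝ)) - 8 / 2 * (1 - n)) :=
  tiStateNode_of_andersonRect 1 8 n 4 2 w_rect2x4rot_opt_U8 v_rect2x4rot_opt_U8
    (by norm_num [Finset.sum_range_succ, w_rect2x4rot_opt_U8])
    (by norm_num [Finset.sum_range_succ, v_rect2x4rot_opt_U8]) h

end AndersonEdge

/-! ## §4  The LTI rectangle-window node (matrix level, the `tl_marginal2d` problem shape) and its PROVED soundness -/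

section LTIRect

/-- **Local translation invariance of a window density matrix** `ρ` on `W ⊆ ℤ²`: for every sub-region `S` and
every lattice vector `v` with `S ⊆ W` and `S + v ⊆ W`, the marginal of `ρ` on `S` and the marginal on `S + v` pulled
back along the translation agree as functionals on the CAR algebra `𝔄_S`
(`Tr ρ Γ(S ↪ W) A = Tr ρ Γ(S → S+v ↪ W) A` for all `A ∈ 𝔄_S`).  This is the 2-D "LTI-x ∧ LTI-y" row family of
`tl_marginal2d` (there: equality of the two `(a-1) × b` sub-rectangle marginals and of the two `a × (b-1)` ones),
stated for all sub-regions at once (equivalent on rectangles, and basis-free). -/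
def WindowLTI {W : Finset (Site 2)} (ρ : FermionOp W) : Prop :=
  ∀ (S : Finset (Site 2)) (v : Site 2) (hS : S ⊆ W) (hSv : shiftSet v S ⊆ W) (A : FermionOp S),
    (ρ * fermionEmbed (PolySite.incl hS) A).trace =
      (ρ * fermionEmbed ((PolySite.shiftEmb v S).trans (PolySite.incl hSv)) A).trace

/-- **Soundness of the LTI rows**: the window marginal of a translation-invariant state is window-LTI. -/
theorem windowLTI_rdm {ω : InfVolFermionState 2} (hω : ω.IsTranslationInvariant) (W : Finset (Site 2)) :
    WindowLTI (ω.rdm W) := by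
  intro S v hS hSv A
  rw [ω.trace_rdm_mul, ω.trace_rdm_mul, ω.compatible hS, ← fermionEmbed_fermionEmbed, ω.compatible hSv,
    ← ω.shift_expect v S A, hω v]

/-- The uniform ("averaged") bond-weight table of the `a × b` rectangle: each of the `(a-1) b` horizontal bonds
carries `1/((a-1) b)`, each of the `a (b-1)` vertical bonds `1/(a (b-1))`. -/
def avgBond (a b : ℕ) : ℕ → ℕ → Fin 2 → ℝ :=
  fun _ _ i => if i = 0 then 1 / (((a - 1 : ℕ) : ℝ) * b) else 1 / ((a : ℝ) * ((b - 1 : ℕ) : ℝ))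

/-- The uniform site-weight table: each of the `a b` sites carries `1/(a b)`. -/
def avgSite (a b : ℕ) : ℕ → ℕ → ℝ := fun _ _ => 1 / ((a : ℝ) * b)

/-- **The averaged window Hamiltonian** `h_avg` of `tl_marginal2d` on the `a × b` rectangle (uniform bond and site
weights summing to `1` per bond direction and to `1` over sites; no chemical-potential term). -/
def hAvg (t U : ℝ) (a b : ℕ) : FermionOp (rectWindow a b) :=
  clusterHamiltonian (rectWindow a b) t U (rectBondWeights (avgBond a b)) (rectSiteWeights (avgSite a b)) fun _ => 0

/-- The uniform horizontal bond weights `1/((a-1)b)` of `avgBond` sum to `1` on `[0,a) × [0,b)` (`a ≥ 2`, `b ≥ 1`). -/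
theorem bondWeightSum_avgBond_zero {a b : ℕ} (ha : 2 ≤ a) (hb : 1 ≤ b) :
    bondWeightSum (rectWindow a b) (rectBondWeights (avgBond a b)) 0 = 1 := by
  rw [bondWeightSum_rect_zero']
  simp only [avgBond, Fin.isValue, ↓reduceIte, Finset.sum_const, Finset.card_range, nsmul_eq_mul]
  have ha' : (0 : ℝ) < ((a - 1 : ℕ) : ℝ) := by exact_mod_cast (show 0 < a - 1 by omega)
  have hb' : (0 : ℝ) < (b : ℝ) := by exact_mod_cast hb
  rw [← mul_assoc, one_div, mul_inv_cancel₀ (mul_pos ha' hb').ne']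

/-- The uniform vertical bond weights `1/(a(b-1))` of `avgBond` sum to `1` on `[0,a) × [0,b)` (`a ≥ 1`, `b ≥ 2`). -/
theorem bondWeightSum_avgBond_one {a b : ℕ} (ha : 1 ≤ a) (hb : 2 ≤ b) :
    bondWeightSum (rectWindow a b) (rectBondWeights (avgBond a b)) 1 = 1 := by
  rw [bondWeightSum_rect_one']
  simp only [avgBond, Fin.isValue, one_ne_zero, ↓reduceIte, Finset.sum_const, Finset.card_range, nsmul_eq_mul]
  have ha' : (0 : ℝ) < (a : ℝ) := by exact_mod_cast ha
  have hb' : (0 : ℝ) < ((b - 1 : ℕ) : ℝ) := by exact_mod_cast (show 0 < b - 1 by omega)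
  rw [← mul_assoc, one_div, mul_inv_cancel₀ (mul_pos ha' hb').ne']

/-- The uniform site weights `1/(ab)` of `avgSite` sum to `1` on `[0,a) × [0,b)`. -/
theorem siteWeightSum_avgSite {a b : ℕ} (ha : 1 ≤ a) (hb : 1 ≤ b) :
    siteWeightSum (rectWindow a b) (rectSiteWeights (avgSite a b)) = 1 := by
  rw [siteWeightSum_rect']
  simp only [avgSite, Finset.sum_const, Finset.card_range, nsmul_eq_mul]
  have ha' : (0 : ℝ) < (a : ℝ) := by exact_mod_cast ha
  have hb' : (0 : ℝ) < (b : ℝ) := by exact_mod_cast hb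
  rw [← mul_assoc, one_div, mul_inv_cancel₀ (mul_pos ha' hb').ne']

/-- The zero site-weight table has weight sum `0`. -/
theorem siteWeightSum_zero (R : Finset (Site 2)) : siteWeightSum R (fun _ => (0 : ℝ)) = 0 := by
  simp [AndersonCluster.siteWeightSum]

/-- `|[0,a) × [0,b)| = a b`. -/
theorem card_rectWindow' (a b : ℕ) : ((rectWindow a b).card : ℝ) = (a : ℝ) * b := by
  rw [Finset.card_eq_sum_ones, Nat.cast_sum, sum_rectWindow_eq']
  simp [Finset.sum_const, Finset.card_range]

/-- **The expectation of `h_avg` in a translation-invariant state is its energy density** (`a, b ≥ 2`). -/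
theorem re_expect_hAvg {t U : ℝ} {ω : InfVolFermionState 2} (hω : ω.IsTranslationInvariant) {a b : ℕ}
    (ha : 2 ≤ a) (hb : 2 ≤ b) : (ω.expect (rectWindow a b) (hAvg t U a b)).re = ω.hubbardEnergyDensity t U := by
  rw [hAvg, expect_clusterHamiltonian hω, Fin.sum_univ_two, bondWeightSum_avgBond_zero ha (by omega),
    bondWeightSum_avgBond_one (by omega) hb, siteWeightSum_avgSite (by omega) (by omega), siteWeightSum_zero,
    hubbardEnergyDensity_eq_re hω, Fin.sum_univ_two]
  simp only [Complex.ofReal_one, one_mul, Complex.ofReal_zero, zero_mul, add_zero, Complex.add_re]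
  ring

/-- **The LTI rectangle node** `LTIRectNode t U a b n lo` (matrix level — the statement a rounded SDP dual
CERTIFIES): every density matrix `ρ` on the CAR algebra of the open `a × b` rectangle (`4^{ab} × 4^{ab}`, PSD,
trace one) which is window-LTI and has mean particle number `a b n` has `Re Tr ρ h_avg ≥ lo`.
Rows = {PSD, trace, LTI (all sub-regions / shifts), density}; NO symmetry-identification, isotropy or sector rows
(those are the separate strengthenings `LTIRectSymNode` / `LTIRectSymGSNode` of §7, sound BY VALUE through the
finite tori). -/
def LTIRectNode (t U : ℝ) (a b : ℕ) (n lo : ℝ) : Prop :=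
  ∀ ρ : FermionOp (rectWindow a b), ρ.PosSemidef → ρ.trace = 1 → WindowLTI ρ →
    ((ρ * totalNumber).trace).re = ((a : ℝ) * b) * n → lo ≤ ((ρ * hAvg t U a b).trace).re

/-- `LTIRectNode` is monotone in the slot: a smaller constant is also a valid floor. -/
theorem LTIRectNode.mono {t U : ℝ} {a b : ℕ} {n lo lo' : ℝ} (h : LTIRectNode t U a b n lo) (hlo : lo' ≤ lo) :
    LTIRectNode t U a b n lo' :=
  fun ρ h1 h2 h3 h4 => hlo.trans (h ρ h1 h2 h3 h4)

/-- **SOUNDNESS of the LTI rectangle node (PROVED transport, `a, b ≥ 2`)**: `LTIRectNode t U a b n lo → TIStateNode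
t U n lo` — the window marginal `ρ_W` of a translation-invariant state of density `n` is feasible for every row
(`rdm_posSemidef`, `trace_rdm`, `windowLTI_rdm`, `re_expect_totalNumber`) and its objective value is the state's
energy density (`re_expect_hAvg`).  With `TIStateNode.le_energyDensity2D` / `.m3EnergyLowerRow`: a certified
`LTIRectNode 1 8 a b (7/8) lo` is a certified `M3EnergyLowerRow 0 lo`. -/
theorem LTIRectNode.tiStateNode {t U : ℝ} {a b : ℕ} (ha : 2 ≤ a) (hb : 2 ≤ b) {n lo : ℝ}
    (h : LTIRectNode t U a b n lo) : TIStateNode t U n lo := by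
  intro ω hti _ hd
  have key := h (ω.rdm (rectWindow a b)) (ω.rdm_posSemidef _) (ω.trace_rdm _) (windowLTI_rdm hti _)
    (by rw [ω.trace_rdm_mul, hti.re_expect_totalNumber, card_rectWindow', hd])
  rwa [ω.trace_rdm_mul, re_expect_hAvg hti ha hb] at key

/-- The end-to-end cell: a certified LTI rectangle bound at the target of record is an `M3` row. -/
theorem LTIRectNode.m3EnergyLowerRow {a b : ℕ} (ha : 2 ≤ a) (hb : 2 ≤ b) {lo : ℚ}
    (h : LTIRectNode 1 8 a b (7 / 8) lo) : M3EnergyLowerRow 0 lo :=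
  (h.tiStateNode ha hb).m3EnergyLowerRow

/-- … and at half filling an `M2` row. -/
theorem LTIRectNode.m2EnergyLowerRow {U : ℝ} (hU : 0 ≤ U) {a b : ℕ} (ha : 2 ≤ a) (hb : 2 ≤ b) {lo : ℚ}
    (h : LTIRectNode 1 U a b 1 lo) : M2EnergyLowerRow U lo :=
  (h.tiStateNode ha hb).m2EnergyLowerRow hU

end LTIRect

end Summit.Ventures.CertifiedManyBodySolver.Rows.RectMarginalNodes

end
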